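import Summits.Ventures.PercRepro.Night2LocalD3ThreeTwoB

/-!
# PercRepro — the cell `(a, k) = (3, 2)` at `|E ∖ G| = 3`, `q = 4`: the far sets with `S ∖ x ∈ U_G`, structure (night-2, gen 13)

Sequel of `Night2LocalD3ThreeTwo.lean` / `Night2LocalD3ThreeTwoB.lean` (`coloops S = K ∪ {x}`, `|S| = 6`, the non-coloops
`T` of `S` a three-point line).  The members carrying layer-2 weight at `S` are among the three candidates
`cand w = insert w (coloops S)` (`w ∈ T`, `exists_nonColoop_eq_insert_of_mem_ex2`).  This file records the first half of the
plane geometry of the remaining case `S ∖ x ∈ U_G` (`proofs/NIGHT-2-dq3.md` §5.5):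

* `S ∖ v` is independent for `v ∈ T` (`indep_erase_of_mem_nonColoops`) and `T ∖ w ⊆ G ∖ cl(cand w)`
  (`not_mem_clF_cand_of_ne`: a second non-coloop in `cl(cand w)` would put the independent five-set `S ∖ u'` in a rank-`4` closure);
* the rank lemma `not_mem_clF_insert_K_of_ne`: for two points `a ≠ p` of `G ∖ K`, `p ∉ cl(K ∪ {a})`
  (`ρ(K ∪ {a}) ≤ 3 < 4 = ρ(K ∪ {a, p})`);
* a member `B ⊇ coloops S` with `G ∖ S ⊆ cl B` forces `S ∖ x ∉ U_G` (`not_erase_mem_Uq_of_subset_clF`, the generalisation of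
  `not_erase_mem_Uq_of_fat`), so with `S ∖ x ∈ U_G` every member candidate is THIN: `|G ∖ cl(cand w)| ≥ 3`
  (`three_le_card_sdiff_clF_cand`).
The traces `(G ∖ S) ∩ cl(cand w)` and their count are in `Night2LocalD3ThreeTwoTrace.lean`.
-/

open scoped Matroid

namespace PercRepro.Shadow

open Finset PerFlat ThmH

variable {α : Type*} [DecidableEq α] {M : Matroid α} [M.Finite]

section ThreeTwoC

variable {G S : Finset α}

/-- Membership in `nonColoops`. -/
theorem mem_nonColoops {e : α} : e ∈ nonColoops M S ↔ e ∈ S ∧ e ∉ coloops M S := by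
  unfold nonColoops; exact Finset.mem_sdiff

/-- `S = coloops S ∪ nonColoops S`, as a membership statement. -/
theorem mem_coloops_or_mem_nonColoops {e : α} (he : e ∈ S) : e ∈ coloops M S ∨ e ∈ nonColoops M S := by
  by_cases h : e ∈ coloops M S
  · exact Or.inl h
  · exact Or.inr (mem_nonColoops.2 ⟨he, h⟩)

open scoped Classical in
/-- **Every member carrying layer-2 weight at a far set with three coloops is a candidate `cand w = coloops S ∪ {w}`** with
`w` a non-coloop of `S`. -/
theorem exists_nonColoop_eq_insert_of_mem_ex2 (hs : ∀ e ∈ gr M, ∀ f ∈ gr M, e ≠ f → rkN M {e, f} = 2)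
    (hG : G ∈ flatsQ M (4 + 1)) (hS : S ∈ shadowAt M (4 + 2) 4 (Uq M (4 + 2) 4) G) (ha : (coloops M S).card = 3)
    {B : Finset α} (hB : B ∈ ex2 M 4 G S) : ∃ w ∈ nonColoops M S, B = insert w (coloops M S) := by
  have hS6 : S.card = 6 := card_eq_six_of_three hs hG hS ha hB
  obtain ⟨-, -, hBS, -, hcard⟩ := mem_ex2_unpack hB
  have hcolB : coloops M S ⊆ B := fun e he => mem_of_mem_ex2_of_mem_coloops hG hS hB he
  have hB4 : B.card = 4 := by
    have := Finset.card_sdiff_add_card_eq_card hBS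
    omega
  have hdiff : (B \ coloops M S).card = 1 := by
    have := Finset.card_sdiff_add_card_eq_card hcolB
    omega
  obtain ⟨w, hw⟩ := Finset.card_eq_one.1 hdiff
  have hwmem : w ∈ B \ coloops M S := by rw [hw]; exact Finset.mem_singleton_self w
  rw [Finset.mem_sdiff] at hwmem
  refine ⟨w, mem_nonColoops.2 ⟨hBS hwmem.1, hwmem.2⟩, ?_⟩
  ext e
  rw [Finset.mem_insert]
  constructor
  · intro he
    by_cases hec : e ∈ coloops M S
    · exact Or.inr hec
    · left
      have : e ∈ B \ coloops M S := Finset.mem_sdiff.2 ⟨he, hec⟩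
      rw [hw, Finset.mem_singleton] at this
      exact this
  · rintro (rfl | he)
    · exact hwmem.1
    · exact hcolB he

/-- `S ∖ v` is independent for a non-coloop `v` of a six-element shadow set. -/
theorem indep_erase_of_mem_nonColoops (hG : G ∈ flatsQ M (4 + 1))
    (hS : S ∈ shadowAt M (4 + 2) 4 (Uq M (4 + 2) 4) G) (hS6 : S.card = 6) {v : α} (hv : v ∈ nonColoops M S) :
    M.Indep ((S.erase v : Finset α) : Set α) := by
  rw [mem_nonColoops] at hv
  exact indep_erase_of_not_coloop hG hS hS6 hv.1 hv.2

/-- With three non-coloops `T = {w, u, u'}`, the set `S ∖ u'` is `coloops S ∪ {w, u}`. -/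
theorem exists_third_nonColoop (hT : (nonColoops M S).card = 3) {w u : α} (hw : w ∈ nonColoops M S)
    (hu : u ∈ nonColoops M S) (hwu : w ≠ u) :
    ∃ u' ∈ nonColoops M S, u' ≠ w ∧ u' ≠ u ∧ S.erase u' = insert u (insert w (coloops M S)) := by
  have h2 : (((nonColoops M S).erase w).erase u).card = 1 := by
    rw [Finset.card_erase_of_mem (Finset.mem_erase.2 ⟨hwu.symm, hu⟩), Finset.card_erase_of_mem hw, hT]
  obtain ⟨u', hu'⟩ := Finset.card_eq_one.1 h2
  have hu'mem : u' ∈ ((nonColoops M S).erase w).erase u := by rw [hu']; exact Finset.mem_singleton_self _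
  rw [Finset.mem_erase, Finset.mem_erase] at hu'mem
  obtain ⟨hu'u, hu'w, hu'T⟩ := hu'mem
  refine ⟨u', hu'T, hu'w, hu'u, ?_⟩
  ext e
  simp only [Finset.mem_erase, Finset.mem_insert]
  constructor
  · rintro ⟨heu', heS⟩
    by_cases hec : e ∈ coloops M S
    · exact Or.inr (Or.inr hec)
    · by_cases hew : e = w
      · exact Or.inr (Or.inl hew)
      by_cases heu : e = u
      · exact Or.inl heu
      have hmem : e ∈ ((nonColoops M S).erase w).erase u := by
        rw [Finset.mem_erase, Finset.mem_erase]
        exact ⟨heu, hew, mem_nonColoops.2 ⟨heS, hec⟩⟩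
      rw [hu', Finset.mem_singleton] at hmem
      exact absurd hmem heu'
  · rintro (rfl | rfl | hec)
    · exact ⟨hu'u.symm, (mem_nonColoops.1 hu).1⟩
    · exact ⟨hu'w.symm, (mem_nonColoops.1 hw).1⟩
    · refine ⟨?_, coloops_subset_self S hec⟩
      rintro rfl
      exact (mem_nonColoops.1 hu'T).2 hec

/-- A candidate `cand w = insert w (coloops S)` lies in `S ∖ u'` for every other non-coloop `u'`. -/
theorem insert_coloops_subset_erase {w u' : α} (hw : w ∈ nonColoops M S) (hu' : u' ∈ nonColoops M S)
    (hwu' : w ≠ u') : insert w (coloops M S) ⊆ S.erase u' := by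
  intro e he
  rw [Finset.mem_insert] at he
  rw [Finset.mem_erase]
  rcases he with rfl | he
  · exact ⟨hwu', (mem_nonColoops.1 hw).1⟩
  · refine ⟨?_, coloops_subset_self S he⟩
    rintro rfl
    exact (mem_nonColoops.1 hu').2 he

open scoped Classical in
/-- **A second non-coloop never lies in the closure of a candidate**: `u ∈ cl(cand w)` (`u ≠ w`) would put the independent
five-set `S ∖ u'` inside `cl(cand w)`, of rank `≤ 4`. -/
theorem not_mem_clF_cand_of_ne (hG : G ∈ flatsQ M (4 + 1)) (hS : S ∈ shadowAt M (4 + 2) 4 (Uq M (4 + 2) 4) G)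
    (hS6 : S.card = 6) (hT : (nonColoops M S).card = 3) {w u : α} (hw : w ∈ nonColoops M S)
    (hu : u ∈ nonColoops M S) (hwu : w ≠ u) : u ∉ clF M (insert w (coloops M S)) := by
  intro hucl
  obtain ⟨u', hu'T, -, -, hSu'⟩ := exists_third_nonColoop hT hw hu hwu
  have hI : M.Indep ((S.erase u' : Finset α) : Set α) := indep_erase_of_mem_nonColoops hG hS hS6 hu'T
  have hr5 : rkN M (S.erase u') = 5 := by
    rw [rkN_eq_card_of_indep hI, Finset.card_erase_of_mem (mem_nonColoops.1 hu'T).1, hS6]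
  have hsub : S.erase u' ⊆ clF M (insert w (coloops M S)) := by
    rw [hSu']
    have hGg : G ⊆ gr M := (mem_flatsQ.1 hG).1
    have hSG : S ⊆ G := subset_of_mem_shadowAt hS
    have h1 : insert w (coloops M S) ⊆ gr M :=
      (Finset.insert_subset (mem_nonColoops.1 hw).1 (coloops_subset_self S)).trans (hSG.trans hGg)
    exact Finset.insert_subset hucl (subset_clF_of_subset_gr h1)
  have h1 := rkN_mono (M := M) hsub
  rw [rkN_clF, hr5] at h1
  have h2 : rkN M (insert w (coloops M S)) ≤ 4 := by
    refine (rkN_le_card _).trans ?_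
    refine (Finset.card_insert_le _ _).trans ?_
    have : (coloops M S).card ≤ 3 := by
      have hc : (coloops M S).card + (nonColoops M S).card = S.card := by
        have := Finset.card_sdiff_add_card_eq_card (coloops_subset_self (M := M) S)
        unfold nonColoops; omega
      omega
    omega
  omega

/-- **Rank lemma**: with `K` the two coloops of `M|G` and `a ≠ p` two points of `G ∖ K`, `p ∉ cl(K ∪ {a})`
(`ρ(K ∪ {a}) ≤ 3 < 4 = ρ(K ∪ {a, p})`). -/
theorem not_mem_clF_insert_K_of_ne (hs : ∀ e ∈ gr M, ∀ f ∈ gr M, e ≠ f → rkN M {e, f} = 2)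
    (hG : G ∈ flatsQ M (4 + 1)) (hk : kColoops M G = 2) {a p : α} (haG : a ∈ G)
    (haK : a ∉ G.filter (fun y => y ∉ clF M (G.erase y))) (hpG : p ∈ G)
    (hpK : p ∉ G.filter (fun y => y ∉ clF M (G.erase y))) (hap : a ≠ p) :
    p ∉ clF M (insert a (G.filter (fun y => y ∉ clF M (G.erase y)))) := by
  set K := G.filter (fun y => y ∉ clF M (G.erase y)) with hKdef
  have hGg : G ⊆ gr M := (mem_flatsQ.1 hG).1
  have hKc : K.card = 2 := by unfold kColoops at hk; rw [← hKdef] at hk; exact hk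
  have hY : ∀ y ∈ K, y ∈ G ∧ y ∉ clF M (G.erase y) := fun y hy => Finset.mem_filter.1 hy
  intro hpcl
  have hr1 : M.eRk ((K ∪ {a} : Finset α) : Set α) = (K.card : ℕ∞) + M.eRk (({a} : Finset α) : Set α) :=
    eRk_union_coloops hGg K hY (Finset.singleton_subset_iff.2 haG) (Finset.disjoint_singleton_right.2 haK)
  have hr2 : M.eRk ((K ∪ {a, p} : Finset α) : Set α) = (K.card : ℕ∞) + M.eRk (({a, p} : Finset α) : Set α) := by
    apply eRk_union_coloops hGg K hY
    · intro e he
      rw [Finset.mem_insert, Finset.mem_singleton] at he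
      rcases he with rfl | rfl
      · exact haG
      · exact hpG
    · rw [Finset.disjoint_insert_right, Finset.disjoint_singleton_right]
      exact ⟨haK, hpK⟩
  have hark : rkN M ({a} : Finset α) ≤ 1 := (rkN_le_card _).trans (by simp)
  have haprk : rkN M ({a, p} : Finset α) = 2 := hs a (hGg haG) p (hGg hpG) hap
  have hr1' : rkN M (K ∪ {a}) ≤ K.card + 1 := by
    rw [eRk_eq_rkN, eRk_eq_rkN] at hr1
    have : rkN M (K ∪ {a}) = K.card + rkN M {a} := by exact_mod_cast hr1
    omega
  have hr2' : rkN M (K ∪ {a, p}) = K.card + 2 := by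
    rw [eRk_eq_rkN, eRk_eq_rkN] at hr2
    have : rkN M (K ∪ {a, p}) = K.card + rkN M {a, p} := by exact_mod_cast hr2
    omega
  have hins : rkN M (insert p (insert a K)) ≤ rkN M (insert a K) :=
    rkN_insert_le_of_mem_clF (Finset.insert_subset (hGg haG) ((Finset.filter_subset _ _).trans hGg)) hpcl
  have he2 : insert p (insert a K) = K ∪ {a, p} := by
    ext e; simp only [Finset.mem_insert, Finset.mem_union, Finset.mem_singleton]; tauto
  have he1 : insert a K = K ∪ {a} := by
    ext e; simp only [Finset.mem_insert, Finset.mem_union, Finset.mem_singleton]; tauto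
  rw [he2, he1] at hins
  omega

open scoped Classical in
/-- **A member candidate whose closure contains `G ∖ S` forces `S ∖ x ∉ U_G`** (the generalisation of
`not_erase_mem_Uq_of_fat` to any member `B ⊇ coloops S`): `ρ((G ∖ S) ∪ {x}) ≤ ρ(B) − |K| = 2`, so
`E ∖ (S ∖ x) ⊆ (G ∖ S) ∪ {x} ∪ (E ∖ G)` has rank `≤ 5`. -/
theorem not_erase_mem_Uq_of_subset_clF (hG : G ∈ flatsQ M (4 + 1)) (hd : (gr M \ G).card = 3)
    (hk : kColoops M G = 2) (hS : S ∈ shadowAt M (4 + 2) 4 (Uq M (4 + 2) 4) G) {x : α}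
    (hxK : x ∉ G.filter (fun y => y ∉ clF M (G.erase y)))
    (hcol : coloops M S = insert x (G.filter (fun y => y ∉ clF M (G.erase y)))) {B : Finset α}
    (hBm : B ∈ membersIn M (Uq M (4 + 2) 4) G) (hcolB : coloops M S ⊆ B) (hP : G \ S ⊆ clF M B) :
    S.erase x ∉ Uq M (4 + 2) 4 := by
  set K := G.filter (fun y => y ∉ clF M (G.erase y)) with hKdef
  have hGg : G ⊆ gr M := (mem_flatsQ.1 hG).1
  have hSG : S ⊆ G := subset_of_mem_shadowAt hS
  have hBU : B ∈ Uq M (4 + 2) 4 := (mem_membersIn.1 hBm).1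
  have hBcl : B ⊆ clF M B := subset_clF hBU
  have hrB : rkN M B = 4 := by
    have h := (mem_Uq.1 hBU).2.1
    rw [eRk_eq_rkN] at h
    exact_mod_cast h
  have hKc : K.card = 2 := by unfold kColoops at hk; rw [← hKdef] at hk; exact hk
  have hxS : x ∈ S := coloops_subset_self S (by rw [hcol]; exact Finset.mem_insert_self x _)
  have hxG : x ∈ G := hSG hxS
  set X := insert x (G \ S) with hXdef
  have hXG : X ⊆ G := Finset.insert_subset hxG Finset.sdiff_subset
  have hXK : Disjoint K X := by
    rw [Finset.disjoint_insert_right]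
    refine ⟨hxK, ?_⟩
    rw [Finset.disjoint_left]
    intro e heK heP
    exact (Finset.mem_sdiff.1 heP).2 (coloops_subset_self S (coloopsG_subset_coloops hS heK))
  have hKXcl : K ∪ X ⊆ clF M B := by
    intro e he
    rw [Finset.mem_union] at he
    rcases he with heK | heX
    · exact hBcl (hcolB (by rw [hcol]; exact Finset.mem_insert_of_mem heK))
    · rw [hXdef, Finset.mem_insert] at heX
      rcases heX with rfl | heP
      · exact hBcl (hcolB (by rw [hcol]; exact Finset.mem_insert_self _ _))
      · exact hP heP
  have hrKX : rkN M (K ∪ X) ≤ 4 := by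
    have := rkN_mono (M := M) hKXcl
    rwa [rkN_clF, hrB] at this
  have hY : ∀ y ∈ K, y ∈ G ∧ y ∉ clF M (G.erase y) := fun y hy => Finset.mem_filter.1 hy
  have hrX : rkN M X ≤ 2 := by
    have h := eRk_union_coloops hGg K hY hXG hXK
    rw [eRk_eq_rkN, eRk_eq_rkN] at h
    have h' : rkN M (K ∪ X) = K.card + rkN M X := by exact_mod_cast h
    omega
  intro hmem
  have hr6 : rkN M (gr M \ S.erase x) = 6 := by
    have h := (mem_Uq.1 hmem).2.2
    rw [eRk_eq_rkN] at h
    exact_mod_cast h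
  have hsub' : gr M \ S.erase x ⊆ X ∪ (gr M \ G) := by
    intro e he
    rw [Finset.mem_sdiff, Finset.mem_erase, not_and_or, not_not] at he
    rw [Finset.mem_union, hXdef, Finset.mem_insert, Finset.mem_sdiff, Finset.mem_sdiff]
    by_cases heG : e ∈ G
    · left
      rcases he.2 with rfl | heS
      · exact Or.inl rfl
      · exact Or.inr ⟨heG, heS⟩
    · right
      exact ⟨he.1, heG⟩
  have h1 : rkN M (gr M \ S.erase x) ≤ rkN M (X ∪ (gr M \ G)) := rkN_mono hsub'
  have h2 := rkN_inter_add_rkN_union_le (M := M) X (gr M \ G)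
  have h3 : rkN M (gr M \ G) ≤ 3 := hd ▸ rkN_le_card _
  omega

open scoped Classical in
/-- **With `S ∖ x ∈ U_G` every member candidate is thin**: `T ∖ w ⊆ G ∖ cl(cand w)` and some point of `G ∖ S` lies outside
`cl(cand w)`, so `|G ∖ cl(cand w)| ≥ 3`. -/
theorem three_le_card_sdiff_clF_cand (hG : G ∈ flatsQ M (4 + 1)) (hd : (gr M \ G).card = 3)
    (hk : kColoops M G = 2) (hS : S ∈ shadowAt M (4 + 2) 4 (Uq M (4 + 2) 4) G) (hS6 : S.card = 6)
    (hT : (nonColoops M S).card = 3) {x : α} (hxK : x ∉ G.filter (fun y => y ∉ clF M (G.erase y)))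
    (hcol : coloops M S = insert x (G.filter (fun y => y ∉ clF M (G.erase y))))
    (hxU : S.erase x ∈ Uq M (4 + 2) 4) {w : α} (hw : w ∈ nonColoops M S)
    (hBm : insert w (coloops M S) ∈ membersIn M (Uq M (4 + 2) 4) G) :
    3 ≤ (G \ clF M (insert w (coloops M S))).card := by
  have hSG : S ⊆ G := subset_of_mem_shadowAt hS
  -- a point of `G ∖ S` outside the closure
  have hnot : ¬ (G \ S ⊆ clF M (insert w (coloops M S))) := fun h =>
    not_erase_mem_Uq_of_subset_clF hG hd hk hS hxK hcol hBm (Finset.subset_insert _ _) h hxU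
  rw [Finset.not_subset] at hnot
  obtain ⟨p, hpP, hpcl⟩ := hnot
  rw [Finset.mem_sdiff] at hpP
  -- the two other non-coloops
  have hsub : insert p ((nonColoops M S).erase w) ⊆ G \ clF M (insert w (coloops M S)) := by
    intro e he
    rw [Finset.mem_insert] at he
    rw [Finset.mem_sdiff]
    rcases he with rfl | he
    · exact ⟨hpP.1, hpcl⟩
    · rw [Finset.mem_erase] at he
      exact ⟨hSG (mem_nonColoops.1 he.2).1, not_mem_clF_cand_of_ne hG hS hS6 hT hw he.2 (Ne.symm he.1)⟩
  refine le_trans ?_ (Finset.card_le_card hsub)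
  rw [Finset.card_insert_of_notMem, Finset.card_erase_of_mem hw, hT]
  intro hp
  exact hpP.2 (mem_nonColoops.1 (Finset.mem_erase.1 hp).2).1

end ThreeTwoC

end PercRepro.Shadow
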